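import Summits.QuantumFields.YangMills.Theorems.LangevinControlUVFemtoCurvatureTwoPointCDefsCore

/-!
# Route `LangevinControlUV`, crux `FemtoCurvatureTwoPointC` (stmt-QuantumFields-16204): line `birth`, the volume bridge for stub D

Line birth reshape (lead c9): D ⟸ R-diagonal on the sub-box 8n + u-free volume comparability VC.

The birth skeleton `Cruxes/FemtoCurvatureTwoPointC/Lines/birth.lean` cuts the femto-engine statement `AFProfilesCoreAt r`
(`…CDefsCore`) into three stubs: R (an INTRINSIC asymptotic-freedom box coupling `u` with DIAGONAL matching
`c·u(L,β)² ≤ ⌊L/8⌋⁸·Cov_{L,β}(P_0^{01}, P_{⌊L/8⌋e₂}^{01}) ≤ C·u(L,β)²` on window boxes `L ≥ 8`), D (finite-volume decoupling: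
for EVERY coupling `u` with the R-properties, the interior transverse matching
`c'·u(8n,β)² ≤ n⁸·Cov_{L,β}(P_0^{01}, P_{ne₂}^{01}) ≤ C'·u(8n,β)²` for `1 ≤ n`, `8n ≤ L` on window boxes) and Ch (channel
domination). This file proves, sorry-free, the purely logical BRIDGE behind the lead's reshape of D into a `u`-free statement:

* `volumeDecoupling_of_volumeComparability` — for a GIVEN coupling `u` carrying the R-bundle (hypothesis `hR`, verbatim the
  antecedent of the registered `stub_volumeDecoupling`), the conclusion of D follows from VOLUME COMPARABILITY VC (hypothesis
  `hVC`, verbatim the body of the lead's `VolumeComparabilityAt r`):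
  `c₁·Cov_{8n,β}(P_0^{01}, P_{ne₂}^{01}) ≤ Cov_{L,β}(P_0^{01}, P_{ne₂}^{01}) ≤ C₁·Cov_{8n,β}(P_0^{01}, P_{ne₂}^{01})` for `1 ≤ n`,
  `8n ≤ L`, `β ≥ β₁` — the curvature two-point amplitude at separation `n` does not feel the box beyond `8n`.

Proof. On a window box `L` (every sub-box `8 ≤ M ≤ L` has `u M β ≤ u₀`) with `8n ≤ L`, the sub-box `8n` is again a window
box, so R's diagonal matching on the box `8n` (where `⌊8n/8⌋ = n`) reads `c·u(8n,β)² ≤ n⁸·Cov_{8n,β} ≤ C·u(8n,β)²`; VC moves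
`Cov_{8n,β}` to `Cov_{L,β}` at the price of the constants. Witnesses: threshold `max β₀ β₁`, `c' = c₁·c`,
`C' = max C₁ 0 · C` (the sign of `Cov_{8n,β}` is forced non-negative by the lower diagonal bound and `u(8n,β) > 0`, which is
why `max C₁ 0` suffices without any sign hypothesis on `C₁`). The real-arithmetic cores are the two private lemmas
`lower_combine` / `upper_combine`.

Design. Both hypotheses are kept CHARACTER FOR CHARACTER equal to the registered texts (the lead instantiates this theorem
with the registered stub bodies in the composition `afProfilesCoreAt_of_birth`). Nothing in this file is physics and nothing
is asserted unconditionally. Deliberately NOT here: VC itself (femto-universe finite-size decoupling at separations a factor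
`8` inside the box; non-perturbatively open), R, Ch, and the scratch `def VolumeComparabilityAt` (inlined instead).
-/

set_option autoImplicit false

noncomputable section

open Filter Topology MeasureTheory
open Literature.MathematicalPhysics.QuantumFieldTheory

namespace Summit.QuantumFields.YangMills.Theorems.FemtoCurvatureTwoPointC

/-- **Lower combination (pure real arithmetic).** From the lower diagonal bound `c·t ≤ N·A'` on the sub-box and the lower
volume comparability `c₁·A' ≤ A`, with `0 ≤ c₁` and `0 ≤ N`: `c₁·c·t ≤ N·A`. [folklore] -/
private theorem lower_combine {c c₁ t N A A' : ℝ} (hc₁ : 0 ≤ c₁) (hN : 0 ≤ N)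
    (hlo : c * t ≤ N * A') (hvlo : c₁ * A' ≤ A) : c₁ * c * t ≤ N * A :=
  calc c₁ * c * t = c₁ * (c * t) := by ring
    _ ≤ c₁ * (N * A') := mul_le_mul_of_nonneg_left hlo hc₁
    _ = N * (c₁ * A') := by ring
    _ ≤ N * A := mul_le_mul_of_nonneg_left hvlo hN

/-- **Upper combination (pure real arithmetic).** From the two-sided diagonal bound `c·t ≤ N·A' ≤ C·t` on the sub-box
(`0 < c`, `0 < t`, `0 ≤ N`, whence `0 ≤ A'`) and the upper volume comparability `A ≤ C₁·A'`: `N·A ≤ (max C₁ 0)·C·t`.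
[folklore] -/
private theorem upper_combine {c C C₁ t N A A' : ℝ} (hc : 0 < c) (ht : 0 < t) (hN : 0 ≤ N)
    (hlo : c * t ≤ N * A') (hhi : N * A' ≤ C * t) (hvhi : A ≤ C₁ * A') :
    N * A ≤ max C₁ 0 * C * t := by
  have hA' : 0 ≤ A' := by
    by_contra h
    have hNA' : N * A' ≤ 0 := mul_nonpos_of_nonneg_of_nonpos hN (le_of_lt (not_le.mp h))
    have hct : 0 < c * t := mul_pos hc ht
    linarith
  calc N * A ≤ N * (C₁ * A') := mul_le_mul_of_nonneg_left hvhi hN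
    _ ≤ N * (max C₁ 0 * A') :=
        mul_le_mul_of_nonneg_left (mul_le_mul_of_nonneg_right (le_max_left _ _) hA') hN
    _ = max C₁ 0 * (N * A') := by ring
    _ ≤ max C₁ 0 * (C * t) := mul_le_mul_of_nonneg_left hhi (le_max_right _ _)
    _ = max C₁ 0 * C * t := by ring

/-- **D ⟸ R-diagonal on the sub-box `8n` + volume comparability (line `birth` reshape, lead c9; sorry-free bridge).**
For a compact group `G`, a lattice representation `r`, and a GIVEN box coupling `u : ℕ → ℝ → ℝ` with constants
`u₀ β₀ κ₁ κ₂ κ₃ c C c₈` carrying the R-bundle `hR` (admissibility, continuity, freezing, bare size, in-window comparability,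
dyadic AF step law, and DIAGONAL matching `c·u(L,β)² ≤ ⌊L/8⌋⁸·Cov_{L,β}(P_0^{01}, P_{⌊L/8⌋e₂}^{01}) ≤ C·u(L,β)²` on window boxes
`L ≥ 8`; verbatim the antecedent of the registered `stub_volumeDecoupling`), the `u`-free VOLUME COMPARABILITY `hVC`
(`c₁·Cov_{8n,β} ≤ Cov_{L,β} ≤ C₁·Cov_{8n,β}` of the plaquette two-point function `Cov(P_0^{01}, P_{ne₂}^{01})`, `1 ≤ n`,
`8n ≤ L`, `β ≥ β₁`; verbatim the body of `VolumeComparabilityAt r`) implies D's conclusion: there are `β₁' c' C'`, `0 < c'`,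
with the transverse LOWER matching `c'·u(8n,β)² ≤ n⁸·Cov_{L,β}(P_0^{01}, P_{ne₂}^{01})` (`1 ≤ n`, `8n ≤ L`) and the transverse
UPPER matching `s⁸·Cov_{L,β}(P_0^{01}, P_{se₂}^{01}) ≤ C'·u(8s,β)²` (`8 ≤ L`, `1 ≤ s`, `8s ≤ L`) on window boxes beyond `β₁'`.
Witnesses: `β₁' = max β₀ β₁`, `c' = c₁·c`, `C' = max C₁ 0 · C`. Only the positivity clause `0 < u L β` and the diagonal
matching clause of `hR` are used. Stated in `∀`-form (the shape registered as a sub-goal stub of stmt-QuantumFields-16204, so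
that the `--supports` landing passes `supports.stub-mismatch`); use as
`volumeDecoupling_of_volumeComparability r u u₀ β₀ κ₁ κ₂ κ₃ c C c₈ hR hVC`. [folklore] -/
theorem volumeDecoupling_of_volumeComparability :
    ∀ {G : Type} [Group G] [TopologicalSpace G] [IsTopologicalGroup G] [CompactSpace G]
        [MeasurableSpace G] [BorelSpace G] (r : LatticeRep G) (u : ℕ → ℝ → ℝ) (u₀ β₀ κ₁ κ₂ κ₃ c C c₈ : ℝ),
      (0 < u₀ ∧ 0 < c ∧ 0 < κ₁ ∧ 0 ≤ κ₃ ∧ 0 < c₈ ∧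
        (∀ (L : ℕ) (β : ℝ), 8 ≤ L → β₀ ≤ β → 0 < u L β) ∧
        (∀ L : ℕ, 8 ≤ L → ContinuousOn (u L) (Set.Ici β₀)) ∧
        (∀ L : ℕ, 8 ≤ L → Filter.Tendsto (u L) Filter.atTop (nhds 0)) ∧
        (∀ β : ℝ, β₀ ≤ β → c₈ ≤ β * u 8 β) ∧
        (∀ (L L' : ℕ) (β : ℝ), β₀ ≤ β → 8 ≤ L → L ≤ L' → L' ≤ 2 * L →
            (∀ M : ℕ, 8 ≤ M → M ≤ L → u M β ≤ u₀) → |(u L β)⁻¹ - (u L' β)⁻¹| ≤ κ₂) ∧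
        (∀ (k m : ℕ) (β : ℝ), β₀ ≤ β → (∀ M : ℕ, 8 ≤ M → M ≤ 8 * 2 ^ (k + m) → u M β ≤ u₀) →
            κ₁ * m - κ₃ ≤ (u (8 * 2 ^ k) β)⁻¹ - (u (8 * 2 ^ (k + m)) β)⁻¹ ∧
              (u (8 * 2 ^ k) β)⁻¹ - (u (8 * 2 ^ (k + m)) β)⁻¹ ≤ κ₂ * m + κ₃) ∧
        (∀ (L : ℕ) [NeZero L] (β : ℝ), β₀ ≤ β → 8 ≤ L →
            (∀ M : ℕ, 8 ≤ M → M ≤ L → u M β ≤ u₀) →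
            ∀ (P : (Fin 4 → ZMod L) → Fin 4 → Fin 4 → GaugeConfig 4 L G → ℝ)
              (E : (GaugeConfig 4 L G → ℝ) → ℝ),
              (P = fun x i j U => (r.N : ℝ) - (r.ρ (plaquetteHolonomy U x i j)).trace.re) →
              (E = fun F => wilsonExpectation r.ρ β F) →
              c * u L β ^ 2 ≤
                ((L / 8 : ℕ) : ℝ) ^ 8 * (E (fun U => P 0 0 1 U * P (Pi.single (2 : Fin 4) ((L / 8 : ℕ) : ZMod L)) 0 1 U)
                  - E (P 0 0 1) * E (P (Pi.single (2 : Fin 4) ((L / 8 : ℕ) : ZMod L)) 0 1)) ∧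
              ((L / 8 : ℕ) : ℝ) ^ 8 * (E (fun U => P 0 0 1 U * P (Pi.single (2 : Fin 4) ((L / 8 : ℕ) : ZMod L)) 0 1 U)
                - E (P 0 0 1) * E (P (Pi.single (2 : Fin 4) ((L / 8 : ℕ) : ZMod L)) 0 1)) ≤ C * u L β ^ 2)) →
      (∃ (β₁ c₁ C₁ : ℝ), 0 < c₁ ∧
        ∀ (L n : ℕ) [NeZero L] [NeZero (8 * n)] (β : ℝ), β₁ ≤ β → 1 ≤ n → 8 * n ≤ L →
          ∀ (P : (Fin 4 → ZMod L) → Fin 4 → Fin 4 → GaugeConfig 4 L G → ℝ)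
            (E : (GaugeConfig 4 L G → ℝ) → ℝ)
            (P' : (Fin 4 → ZMod (8 * n)) → Fin 4 → Fin 4 → GaugeConfig 4 (8 * n) G → ℝ)
            (E' : (GaugeConfig 4 (8 * n) G → ℝ) → ℝ),
            (P = fun x i j U => (r.N : ℝ) - (r.ρ (plaquetteHolonomy U x i j)).trace.re) →
            (E = fun F => wilsonExpectation r.ρ β F) →
            (P' = fun x i j U => (r.N : ℝ) - (r.ρ (plaquetteHolonomy U x i j)).trace.re) →
            (E' = fun F => wilsonExpectation r.ρ β F) →
            c₁ * (E' (fun U => P' 0 0 1 U * P' (Pi.single (2 : Fin 4) ((n : ℕ) : ZMod (8 * n))) 0 1 U)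
                    - E' (P' 0 0 1) * E' (P' (Pi.single (2 : Fin 4) ((n : ℕ) : ZMod (8 * n))) 0 1)) ≤
              (E (fun U => P 0 0 1 U * P (Pi.single (2 : Fin 4) ((n : ℕ) : ZMod L)) 0 1 U)
                - E (P 0 0 1) * E (P (Pi.single (2 : Fin 4) ((n : ℕ) : ZMod L)) 0 1)) ∧
            (E (fun U => P 0 0 1 U * P (Pi.single (2 : Fin 4) ((n : ℕ) : ZMod L)) 0 1 U)
                - E (P 0 0 1) * E (P (Pi.single (2 : Fin 4) ((n : ℕ) : ZMod L)) 0 1)) ≤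
              C₁ * (E' (fun U => P' 0 0 1 U * P' (Pi.single (2 : Fin 4) ((n : ℕ) : ZMod (8 * n))) 0 1 U)
                    - E' (P' 0 0 1) * E' (P' (Pi.single (2 : Fin 4) ((n : ℕ) : ZMod (8 * n))) 0 1))) →
      ∃ (β₁ c' C' : ℝ), 0 < c' ∧
        (∀ (L : ℕ) [NeZero L] (β : ℝ) (n : ℕ), β₁ ≤ β → 1 ≤ n → 8 * n ≤ L →
            (∀ M : ℕ, 8 ≤ M → M ≤ L → u M β ≤ u₀) →
            ∀ (P : (Fin 4 → ZMod L) → Fin 4 → Fin 4 → GaugeConfig 4 L G → ℝ)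
              (E : (GaugeConfig 4 L G → ℝ) → ℝ),
              (P = fun x i j U => (r.N : ℝ) - (r.ρ (plaquetteHolonomy U x i j)).trace.re) →
              (E = fun F => wilsonExpectation r.ρ β F) →
              c' * u (8 * n) β ^ 2 ≤
                (n : ℝ) ^ 8 * (E (fun U => P 0 0 1 U * P (Pi.single (2 : Fin 4) ((n : ℕ) : ZMod L)) 0 1 U)
                  - E (P 0 0 1) * E (P (Pi.single (2 : Fin 4) ((n : ℕ) : ZMod L)) 0 1))) ∧
        (∀ (L : ℕ) [NeZero L] (β : ℝ) (s : ℕ), β₁ ≤ β → 8 ≤ L → 1 ≤ s → 8 * s ≤ L →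
            (∀ M : ℕ, 8 ≤ M → M ≤ L → u M β ≤ u₀) →
            ∀ (P : (Fin 4 → ZMod L) → Fin 4 → Fin 4 → GaugeConfig 4 L G → ℝ)
              (E : (GaugeConfig 4 L G → ℝ) → ℝ),
              (P = fun x i j U => (r.N : ℝ) - (r.ρ (plaquetteHolonomy U x i j)).trace.re) →
              (E = fun F => wilsonExpectation r.ρ β F) →
              (s : ℝ) ^ 8 * (E (fun U => P 0 0 1 U * P (Pi.single (2 : Fin 4) ((s : ℕ) : ZMod L)) 0 1 U)
                  - E (P 0 0 1) * E (P (Pi.single (2 : Fin 4) ((s : ℕ) : ZMod L)) 0 1)) ≤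
                C' * u (8 * s) β ^ 2) := by
  intro G _ _ _ _ _ _ r u u₀ β₀ κ₁ κ₂ κ₃ c C c₈ hR hVC
  obtain ⟨β₁, c₁, C₁, hc₁, hvc⟩ := hVC
  obtain ⟨-, hc, -, -, -, hpos, -, -, -, -, -, hdiag⟩ := hR
  refine ⟨max β₀ β₁, c₁ * c, max C₁ 0 * C, mul_pos hc₁ hc, ?_, ?_⟩
  · -- transverse LOWER matching at separation `n` on the box `L`
    intro L _ β n hβ hn hnL hwin P E hP hE
    haveI : NeZero (8 * n) := ⟨by omega⟩
    have hβ₀ : β₀ ≤ β := (le_max_left _ _).trans hβ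
    have hβ₁ : β₁ ≤ β := (le_max_right _ _).trans hβ
    have h8 : 8 ≤ 8 * n := by omega
    -- the sub-box `8n ≤ L` is again a window box
    have hwin' : ∀ M : ℕ, 8 ≤ M → M ≤ 8 * n → u M β ≤ u₀ := fun M hM hMle => hwin M hM (hMle.trans hnL)
    -- the plaquette observable and the Wilson expectation on the sub-box `8n`
    set P' : (Fin 4 → ZMod (8 * n)) → Fin 4 → Fin 4 → GaugeConfig 4 (8 * n) G → ℝ :=
      fun x i j U => (r.N : ℝ) - (r.ρ (plaquetteHolonomy U x i j)).trace.re with hP'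
    set E' : (GaugeConfig 4 (8 * n) G → ℝ) → ℝ := fun F => wilsonExpectation r.ρ β F with hE'
    -- R's diagonal matching on the box `8n` (`⌊8n/8⌋ = n`)
    obtain ⟨hlo, hhi⟩ := hdiag (8 * n) β hβ₀ h8 hwin' P' E' hP' hE'
    have e : 8 * n / 8 = n := by omega
    rw [e] at hlo hhi
    -- volume comparability between the boxes `8n` and `L`
    obtain ⟨hvlo, hvhi⟩ := hvc L n β hβ₁ hn hnL P E P' E' hP hE hP' hE'
    exact lower_combine hc₁.le (pow_nonneg (Nat.cast_nonneg n) 8) hlo hvlo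
  · -- transverse UPPER matching at separation `s` on the box `L`
    intro L _ β s hβ hL hs hsL hwin P E hP hE
    haveI : NeZero (8 * s) := ⟨by omega⟩
    have hβ₀ : β₀ ≤ β := (le_max_left _ _).trans hβ
    have hβ₁ : β₁ ≤ β := (le_max_right _ _).trans hβ
    have h8 : 8 ≤ 8 * s := by omega
    have hwin' : ∀ M : ℕ, 8 ≤ M → M ≤ 8 * s → u M β ≤ u₀ := fun M hM hMle => hwin M hM (hMle.trans hsL)
    set P' : (Fin 4 → ZMod (8 * s)) → Fin 4 → Fin 4 → GaugeConfig 4 (8 * s) G → ℝ :=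
      fun x i j U => (r.N : ℝ) - (r.ρ (plaquetteHolonomy U x i j)).trace.re with hP'
    set E' : (GaugeConfig 4 (8 * s) G → ℝ) → ℝ := fun F => wilsonExpectation r.ρ β F with hE'
    obtain ⟨hlo, hhi⟩ := hdiag (8 * s) β hβ₀ h8 hwin' P' E' hP' hE'
    have e : 8 * s / 8 = s := by omega
    rw [e] at hlo hhi
    obtain ⟨hvlo, hvhi⟩ := hvc L s β hβ₁ hs hsL P E P' E' hP hE hP' hE'
    have ht : 0 < u (8 * s) β ^ 2 := pow_pos (hpos (8 * s) β h8 hβ₀) 2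
    exact upper_combine hc ht (pow_nonneg (Nat.cast_nonneg s) 8) hlo hhi hvhi

end Summit.QuantumFields.YangMills.Theorems.FemtoCurvatureTwoPointC

end
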